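import Summits.Ventures.AbcShadow.SH01.BVY04Package

/-!
# Venture AbcShadow — the [BVY04, Lemma 3.4] branch `n ∣ AB` as a NAMED HYPOTHESIS (needed by the pair `(61, 61)` of Thm 1.6 only)

HONEST FRAMING. Interface file of the work-bound cell `abc-shadow` (typer seat `abc-shadow-typ-1`, lineage g3). NOTHING here is a theorem
about a Diophantine equation; nothing here is a claim on abc or on any summit; no side on IUT. g0's `CMNewformModel.BVY04Package`
(`SH01/BVY04Package.lean`) types [BVY04, Lemma 3.4 + Cor 3.3 + Prop 4.2] in the GENERIC branch `n ∤ ABC` only (its docstring and crit-1's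
faithfulness memo, remark R2, say so). Of the ten printed possibly-exceptional pairs of [BVY04, Thm 1.6] exactly one, `(p, n) = (61, 61)`, has
`p = n`: for `x⁶¹ + 61^α y⁶¹ = z³` the exponent `n = 61` DIVIDES `AB = 61^e`, and Lemma 3.4's SECOND branch applies. This file types that branch,
verbatim in everything except ONE READING which it flags (below), as the named hypothesis `CMNewformModel.BVY04PackageDvdAB`, so that the typed
row `SH04/Row61_61.lean` can display it as the extra print input on which the cell's closure of `(61, 61)` rests.

PRINT (p. 1406, Lemma 3.4, as transcribed in the cell's memo crit-1-SH01-faithful.md item 6): «n ⩾ 5 prime … primitive solution (a, b, c) with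
ab ≠ ±1. N_n(E) = N_n^E if n ∤ ABC, nN_n^E if n ∣ AB, n²N_n^E if n ∣ C. Then ρ_{E,n} arises from a cuspidal newform of weight 2, level N_n(E)
and trivial Nebentypus character, unless E corresponds to one of the equations 1·2⁵ + 27·(−1)⁵ = 5·1³ or 1·2⁷ + 3·(−1)⁷ = 1·5³»; Cor 3.3
(p. 1405): «N_n^E = Rad*(AB) Rad*(C)² ε′₃» with the `ε′₃` table; Prop 4.2 (pp. 1406–7): «If p is a prime, coprime to nN_n^E, then n divides
Norm_{K_f/ℚ}(c_p − a_p) where a_p ∈ S_p».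

THE READING (flagged for the critic; the one place where this file interprets print): `N_n^E` is the conductor of the mod-`n` representation
`ρ_{E,n}` ([Thm 3.2] = Kraus's theorem; [Cor 3.3]), an integer PRIME TO `n` by definition; under `n ∣ AB` the printed product
`Rad*(AB)·Rad*(C)²·ε′₃` contains the prime `n` exactly once (in `Rad*(AB)`; `E` has multiplicative reduction at the primes of `AB`, [Lemma 2.1]),
and print's level `n·N_n^E` of this branch is read as THAT product: `N_n(E) = Rad*(AB)·Rad*(C)²·ε′₃ = bvy04Level κ A B C` (the typed level
function of g0, unchanged). This is the level at which the cell's engine (certificate 4a36c28685fe0350 part C: levels `183, 549, 1647 = 3^δ·61`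
for the pair `(61, 61)`), its critic (crit-1 j314495) and both blind referees worked. Were Cor 3.3's `N_n^E` read as literally including the
factor `n`, print's `n·N_n^E` would be `3^δ·61²` instead, and neither this hypothesis nor the census closure of `(61, 61)` would be what print
gives — the critic's K-line on this reading is requested in the row's bus line. Everything else is typed exactly as in `BVY04Package`:
standing hypotheses of p. 1401, `ab ≠ ±1`, the two exceptional equations excluded through the larger exclusion `(AB, n) ∉ {(27,5), (3,7)}`,
conclusion = a newform `f` of that level with `M.Arises S N f`, and the [Prop 4.2] congruences `M.ArisesMod f n bvy04AllowedPrint` (a single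
prime above `n`; primes `ℓ ∤ 2nN` — print: all `p` coprime to `nN_n^E`; we ask less). CITED (+ one reading), never proved here.
References: [BVY04] Bennett–Vatsal–Yazdani, Compositio Math. 140 (2004), Lemma 2.1 p.1401, Thm 3.2/Cor 3.3 p.1405, Lemma 3.4 p.1406,
Prop 4.2 pp.1406–1407. AI-typed; weaker than expert refereeing.
-/

namespace Summit.Ventures.AbcShadow

open Summit.Ventures.AbcSig (NewformModel FreyDatum OrbitData)

/-- **NAMED HYPOTHESIS [BVY04, Lemma 3.4 (branch `n ∣ AB`) + Cor 3.3 + Prop 4.2 (via the definition p. 1405)]** — the modular-method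
package for signature `(n, n, 3)` in the branch where the prime exponent `n` divides `AB`: a primitive solution (print's standing hypotheses:
`Aa, Bb, Cc` pairwise coprime and nonzero, `C` cube-free, `A, B` `n`-th-power free, `3 ∤ Aa`, `Bbⁿ ≢ 2 (mod 3)`, `ab ≠ ±1`, prime `n ≥ 5`,
`(AB, n) ∉ {(27,5), (3,7)}`) with `n ∣ AB`, in row `κ` of the `ε′₃` table, yields a newform `f` of weight 2 and level `N_n(E) = n·N_n^E`, READ
(module docstring) as `Rad*(AB)·Rad*(C)²·ε′₃ = bvy04Level κ A B C` (the prime `n` once), with `M.Arises S N f`, and every such `f` satisfies the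
[Prop 4.2] congruences `M.ArisesMod f n bvy04AllowedPrint`. Used ONLY by the row `(61, 61)`. CITED + ONE READING, never proved here.
[cite: BennettVatsalYazdani2004, Lemma 3.4 p.1406 (branch n ∣ AB); Cor 3.3 p.1405; Prop 4.2 pp.1406-1407; def. p.1405] -/
def CMNewformModel.BVY04PackageDvdAB (M : CMNewformModel) : Prop :=
  ∀ (S : FreyDatum) (κ : BVYCase),
    0 < S.A → 0 < S.B → 0 < S.C →
    (∀ q : ℕ, q.Prime → ¬ q ^ 3 ∣ S.C) →
    (∀ q : ℕ, q.Prime → ¬ q ^ S.n ∣ S.A ∧ ¬ q ^ S.n ∣ S.B) →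
    S.n.Prime → 5 ≤ S.n → S.n ∣ S.A * S.B →
    ¬ (3 : ℤ) ∣ (S.A : ℤ) * S.a → ¬ (3 : ℤ) ∣ (S.B : ℤ) * S.b ^ S.n - 2 →
    IsPrimitiveSolution S.A S.B S.C S.n S.a S.b S.c → S.a * S.b ≠ 1 → S.a * S.b ≠ -1 →
    ¬ (S.A * S.B = 27 ∧ S.n = 5) → ¬ (S.A * S.B = 3 ∧ S.n = 7) →
    κ.Holds S.A S.B S.C S.n S.a S.b S.c →
    ∀ N : ℕ, bvy04Level κ S.A S.B S.C = N →
      (∃ f : M.Form N, M.Arises S N f) ∧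
      (∀ f : M.Form N, M.Arises S N f → M.ArisesMod f S.n bvy04AllowedPrint)

end Summit.Ventures.AbcShadow
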